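import Mathlib.Analysis.PSeries
import Literature.NumberTheory.LFunctions.WeilMellinBounds
import Literature.NumberTheory.LFunctions.WeilArchimedeanMoments
import HarnessLib

/-!
# Summable domination of `ĝ` along a poly-profile configuration (`stub_domination`)

Stub `stub_domination` of the line `defect-compactness-design` for the crux `WindowTraceArch`
(stmt-RiemannHypothesis-11195; skeleton
`Summit.RiemannHypothesis.RiemannHypothesis.Cruxes.WindowTraceArch.DefectCompactnessDesign`).

**Statement.** Let `x : ℕ → ℝ` be a configuration with a polynomial local count profile: every
finset `s` of indices with `|x n - T| ≤ 1` on `s` has `#s ≤ C (1 + |T|) ^ N`. Let `D : ℝ` be a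
displacement budget. Then there are `K : ℝ` and `k : ℕ` (we take `k = N + 2`) such that for every
Weil test `f` (smooth, compactly supported) there is a summable `b : ℕ → ℝ` with
`‖f̂(1/2 + i (x n + v))‖ ≤ b n` for all `n` and all `|v| ≤ D`, and
`∑ b ≤ K (∫ ‖f‖ + ∫ ‖f^{(k)}‖)`. Here `f̂ = weilMellin f`, whose restriction to the critical line is
the Fourier transform of `f`.

**Proof sketch.**
* Decay: `‖f̂(1/2 + iu)‖ ≤ ∫ ‖f‖` (`norm_weilMellin_half_line_le`) and, after `k` integrations by
  parts (`weilMellin_deriv`, `IsWeilTest.deriv`, `iteratedDeriv_eq_iterate`),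
  `|u| ^ k ‖f̂(1/2 + iu)‖ = ‖(f^{(k)})̂(1/2 + iu)‖ ≤ ∫ ‖f^{(k)}‖`; hence
  `‖f̂(1/2 + iu)‖ ≤ 2 ^ k (∫ ‖f‖ + ∫ ‖f^{(k)}‖) / (1 + |u|) ^ k`.
* Displacement: for `|v| ≤ D`, `1 + |x n| ≤ (1 + |D|) (1 + |x n + v|)`.
* Counting: `∑ₙ (1 + |x n|)^{-(N+2)} < ∞` with an explicit bound on all finite partial sums: sort the
  indices of a finset into the cells `⌊x n⌋ = m ∈ ℤ`; a cell holds at most `C (1 + |m + 1/2|) ^ N`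
  indices (profile at `T = m + 1/2`) on each of which `(1 + |x n|)^{-k} ≤ 2 ^ k (1 + |m|)^{-k}`, and
  `∑_{m ∈ ℤ} (1 + |m|)^{-2} < ∞`. Nonnegative terms with uniformly bounded partial sums are summable
  (`summable_of_sum_le`, `Real.tsum_le_of_sum_le`).
* So `b n := S · 2^k (1+|D|)^k · (1 + |x n|)^{-k}` with `S = ∫ ‖f‖ + ∫ ‖f^{(k)}‖` works, with
  `K = 2^k (1+|D|)^k · B`, `B` the partial-sum bound (independent of `f`).

**Sources.** Standard Fourier analysis (decay of the Fourier transform of a smooth compactly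
supported function by integration by parts; e.g. E. M. Stein, R. Shakarchi, *Fourier Analysis*
(2003), Ch. 5, §1) and elementary counting. All ingredients are proved tree / Mathlib facts.
[folklore]
-/

set_option linter.dupNamespace false

noncomputable section

open Complex MeasureTheory
open scoped Real Topology BigOperators

namespace Summit.RiemannHypothesis.RiemannHypothesis.Theorems.SpectralTraceWindowTraceArch

open Literature.NumberTheory.LFunctions

/-! ## Counting: summability of `(1 + |x n|)^{-(N+2)}` from the count profile -/

/-- The series `∑_{m ∈ ℤ} (1 + |m|)^{-2}` converges. [folklore] -/
theorem stub_domination_summable_int :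
    Summable (fun m : ℤ => ((1 + |(m : ℝ)|) ^ 2)⁻¹) := by
  have h : Summable (fun n : ℕ => ((1 + (n : ℝ)) ^ 2)⁻¹) := by
    have h1 : Summable (fun n : ℕ => (((n + 1 : ℕ) : ℝ) ^ 2)⁻¹) :=
      (summable_nat_add_iff 1).2 (Real.summable_nat_pow_inv.2 one_lt_two)
    refine h1.congr fun n => ?_
    push_cast
    ring
  refine Summable.of_nat_of_neg ?_ ?_
  · simpa [Nat.abs_cast] using h
  · simpa [Nat.abs_cast, abs_neg] using h

/-- Uniform bound on the partial sums of `(1 + |x n|)^{-(N+2)}` for a configuration with the count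
profile `#{n ∈ s : |x n - T| ≤ 1} ≤ C (1 + |T|) ^ N`: sort the indices into the integer cells
`⌊x n⌋ = m`. [folklore] -/
theorem stub_domination_sum_le (x : ℕ → ℝ) (C : ℝ) (N : ℕ)
    (hP : ∀ (T : ℝ) (s : Finset ℕ), (∀ n ∈ s, |x n - T| ≤ 1) → (s.card : ℝ) ≤ C * (1 + |T|) ^ N)
    (s : Finset ℕ) :
    ∑ n ∈ s, ((1 + |x n|) ^ (N + 2))⁻¹ ≤
      C * 2 ^ (2 * N + 2) * ∑' m : ℤ, ((1 + |(m : ℝ)|) ^ 2)⁻¹ := by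
  classical
  have hC : 0 ≤ C := by simpa using hP 0 ∅ (by simp)
  set φ : ℕ → ℤ := fun n => ⌊x n⌋ with hφ
  rw [← Finset.sum_fiberwise_of_maps_to (g := φ) (t := s.image φ)
    (fun n hn => Finset.mem_image_of_mem φ hn)]
  -- the bound on one cell
  have hfib : ∀ m : ℤ, ∑ n ∈ s with φ n = m, ((1 + |x n|) ^ (N + 2))⁻¹ ≤
      C * 2 ^ (2 * N + 2) * ((1 + |(m : ℝ)|) ^ 2)⁻¹ := by
    intro m
    have hm0 : (0 : ℝ) < 1 + |(m : ℝ)| := by positivity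
    -- points of the cell
    have hcell : ∀ n ∈ s.filter (fun n => φ n = m), (m : ℝ) ≤ x n ∧ x n < m + 1 := by
      intro n hn
      have hn' : ⌊x n⌋ = m := (Finset.mem_filter.1 hn).2
      exact ⟨hn' ▸ Int.floor_le (x n), hn' ▸ Int.lt_floor_add_one (x n)⟩
    -- the count profile at `T = m + 1/2`
    have hcard : ((s.filter (fun n => φ n = m)).card : ℝ) ≤ C * (1 + |(m : ℝ) + 1 / 2|) ^ N := by
      refine hP ((m : ℝ) + 1 / 2) _ (fun n hn => ?_)
      obtain ⟨h1, h2⟩ := hcell n hn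
      exact abs_le.2 ⟨by linarith, by linarith⟩
    -- the termwise bound on the cell
    have hterm : ∀ n ∈ s.filter (fun n => φ n = m),
        ((1 + |x n|) ^ (N + 2))⁻¹ ≤ 2 ^ (N + 2) * ((1 + |(m : ℝ)|) ^ (N + 2))⁻¹ := by
      intro n hn
      obtain ⟨h1, h2⟩ := hcell n hn
      have hxn : (0 : ℝ) < 1 + |x n| := by positivity
      have hbase : 1 + |(m : ℝ)| ≤ 2 * (1 + |x n|) := by
        have : |(m : ℝ)| ≤ |x n| + 1 := by
          calc |(m : ℝ)| = |x n + ((m : ℝ) - x n)| := by congr 1; ring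
            _ ≤ |x n| + |(m : ℝ) - x n| := abs_add_le _ _
            _ ≤ |x n| + 1 := by
                gcongr
                exact abs_le.2 ⟨by linarith, by linarith⟩
        linarith [abs_nonneg (x n)]
      rw [← div_eq_mul_inv, le_div_iff₀ (pow_pos hm0 _), inv_mul_le_iff₀ (pow_pos hxn _),
        ← mul_pow]
      gcongr
      linarith
    calc ∑ n ∈ s with φ n = m, ((1 + |x n|) ^ (N + 2))⁻¹
        ≤ ∑ n ∈ s with φ n = m, 2 ^ (N + 2) * ((1 + |(m : ℝ)|) ^ (N + 2))⁻¹ :=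
          Finset.sum_le_sum hterm
      _ = ((s.filter (fun n => φ n = m)).card : ℝ) *
            (2 ^ (N + 2) * ((1 + |(m : ℝ)|) ^ (N + 2))⁻¹) := by
          rw [Finset.sum_const, nsmul_eq_mul]
      _ ≤ C * (1 + |(m : ℝ) + 1 / 2|) ^ N * (2 ^ (N + 2) * ((1 + |(m : ℝ)|) ^ (N + 2))⁻¹) := by
          gcongr
      _ ≤ C * (2 * (1 + |(m : ℝ)|)) ^ N * (2 ^ (N + 2) * ((1 + |(m : ℝ)|) ^ (N + 2))⁻¹) := by
          gcongr
          calc 1 + |(m : ℝ) + 1 / 2| ≤ 1 + (|(m : ℝ)| + |(1 / 2 : ℝ)|) := by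
                gcongr; exact abs_add_le _ _
            _ ≤ 2 * (1 + |(m : ℝ)|) := by
                rw [abs_of_pos (by norm_num : (0 : ℝ) < 1 / 2)]
                linarith [abs_nonneg (m : ℝ)]
      _ = C * 2 ^ (2 * N + 2) * ((1 + |(m : ℝ)|) ^ N * ((1 + |(m : ℝ)|) ^ (N + 2))⁻¹) := by
          rw [mul_pow]
          ring
      _ = C * 2 ^ (2 * N + 2) * ((1 + |(m : ℝ)|) ^ 2)⁻¹ := by
          congr 1
          rw [pow_add, mul_inv, ← mul_assoc, mul_inv_cancel₀ (pow_pos hm0 N).ne', one_mul]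
  calc ∑ m ∈ s.image φ, ∑ n ∈ s with φ n = m, ((1 + |x n|) ^ (N + 2))⁻¹
      ≤ ∑ m ∈ s.image φ, C * 2 ^ (2 * N + 2) * ((1 + |(m : ℝ)|) ^ 2)⁻¹ :=
        Finset.sum_le_sum (fun m _ => hfib m)
    _ = C * 2 ^ (2 * N + 2) * ∑ m ∈ s.image φ, ((1 + |(m : ℝ)|) ^ 2)⁻¹ := by
        rw [Finset.mul_sum]
    _ ≤ C * 2 ^ (2 * N + 2) * ∑' m : ℤ, ((1 + |(m : ℝ)|) ^ 2)⁻¹ := by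
        gcongr
        exact stub_domination_summable_int.sum_le_tsum _ (fun m _ => by positivity)

/-! ## Decay of `f̂` on the critical line by integration by parts -/

/-- Iterated integration by parts: `deriv^[k] f` is a Weil test and
`(f^{(k)})̂(s) = (-(s - 1/2))^k f̂(s)`. [folklore] -/
theorem stub_domination_iterate (k : ℕ) :
    ∀ {f : ℝ → ℂ}, IsWeilTest f →
      IsWeilTest (deriv^[k] f) ∧
        ∀ s : ℂ, weilMellin (deriv^[k] f) s = (-(s - 1 / 2)) ^ k * weilMellin f s := by
  induction k with
  | zero => intro f hf; exact ⟨hf, fun s => by simp⟩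
  | succ k ih =>
    intro f hf
    obtain ⟨hk, hks⟩ := ih hf
    refine ⟨?_, fun s => ?_⟩
    · rw [Function.iterate_succ_apply']
      exact hk.deriv
    · rw [Function.iterate_succ_apply', weilMellin_deriv hk, hks s]
      ring

/-- Decay on the critical line: `‖f̂(1/2 + iu)‖ ≤ 2^k (∫‖f‖ + ∫‖f^{(k)}‖) / (1 + |u|)^k` for a Weil
test `f`. [folklore] -/
theorem stub_domination_decay {f : ℝ → ℂ} (hf : IsWeilTest f) (k : ℕ) (u : ℝ) :
    ‖weilMellin f (1 / 2 + u * I)‖ ≤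
      2 ^ k * ((∫ t, ‖f t‖) + ∫ t, ‖iteratedDeriv k f t‖) * ((1 + |u|) ^ k)⁻¹ := by
  obtain ⟨hk, hks⟩ := stub_domination_iterate k hf
  have h0 : ‖weilMellin f (1 / 2 + u * I)‖ ≤ ∫ t, ‖f t‖ := norm_weilMellin_half_line_le hf u
  have h1 : |u| ^ k * ‖weilMellin f (1 / 2 + u * I)‖ ≤ ∫ t, ‖iteratedDeriv k f t‖ := by
    have h := norm_weilMellin_half_line_le hk u
    rw [hks, norm_mul, norm_pow, norm_neg] at h
    have hn : ‖(1 / 2 + (u : ℂ) * I - 1 / 2 : ℂ)‖ = |u| := by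
      simp [Complex.norm_real]
    rw [hn] at h
    rw [iteratedDeriv_eq_iterate]
    exact h
  have hS0 : 0 ≤ ∫ t, ‖f t‖ := integral_nonneg fun _ => norm_nonneg _
  have hS1 : 0 ≤ ∫ t, ‖iteratedDeriv k f t‖ := integral_nonneg fun _ => norm_nonneg _
  have hpos : 0 < (1 + |u|) ^ k := by positivity
  rw [le_mul_inv_iff₀ hpos]
  rcases le_total |u| 1 with hu | hu
  · have h2 : (1 + |u|) ^ k ≤ (2 : ℝ) ^ k := pow_le_pow_left₀ (by positivity) (by linarith) k
    calc ‖weilMellin f (1 / 2 + u * I)‖ * (1 + |u|) ^ k ≤ (∫ t, ‖f t‖) * 2 ^ k :=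
          mul_le_mul h0 h2 hpos.le hS0
      _ ≤ 2 ^ k * ((∫ t, ‖f t‖) + ∫ t, ‖iteratedDeriv k f t‖) := by
          rw [mul_comm]
          gcongr
          linarith
  · have h2 : (1 + |u|) ^ k ≤ (2 : ℝ) ^ k * |u| ^ k := by
      rw [← mul_pow]
      exact pow_le_pow_left₀ (by positivity) (by linarith) k
    calc ‖weilMellin f (1 / 2 + u * I)‖ * (1 + |u|) ^ k
        ≤ ‖weilMellin f (1 / 2 + u * I)‖ * (2 ^ k * |u| ^ k) := by gcongr
      _ = 2 ^ k * (|u| ^ k * ‖weilMellin f (1 / 2 + u * I)‖) := by ring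
      _ ≤ 2 ^ k * ∫ t, ‖iteratedDeriv k f t‖ := by gcongr
      _ ≤ 2 ^ k * ((∫ t, ‖f t‖) + ∫ t, ‖iteratedDeriv k f t‖) := by
          gcongr
          linarith

/-! ## The stub -/

/-- **stub_domination — summable domination of `ĝ` along a poly-profile configuration.** For a
configuration `x` with `#{n : |x n - T| ≤ 1} ≤ C(1+|T|)^N` and a budget `D` there are `K` and `k`
(we take `k = N + 2`) such that for every Weil test `f` the values `f̂(1/2 + i(xₙ + v))`, `|v| ≤ D`,
are bounded by a summable `bₙ` with `Σ bₙ ≤ K (∫‖f‖ + ∫‖f^{(k)}‖)`. Proof: on the critical line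
`‖f̂(1/2+iu)‖ ≤ 2^k (∫‖f‖ + ∫‖f^{(k)}‖)/(1+|u|)^k` (integration by parts, `stub_domination_decay`),
`1 + |xₙ| ≤ (1 + |D|)(1 + |xₙ + v|)` for `|v| ≤ D`, and `Σₙ (1+|xₙ|)^{-(N+2)}` has uniformly bounded
partial sums by cell counting (`stub_domination_sum_le`). [folklore] -/
theorem stub_domination :
    ∀ (x : ℕ → ℝ) (C D : ℝ) (N : ℕ),
      (∀ (T : ℝ) (s : Finset ℕ), (∀ n ∈ s, |x n - T| ≤ 1) → (s.card : ℝ) ≤ C * (1 + |T|) ^ N) →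
      ∃ (K : ℝ) (k : ℕ), ∀ f : ℝ → ℂ, Literature.NumberTheory.LFunctions.IsWeilTest f →
        ∃ b : ℕ → ℝ, Summable b ∧
          (∀ (n : ℕ) (v : ℝ), |v| ≤ D →
            ‖Literature.NumberTheory.LFunctions.weilMellin f (1 / 2 + ((x n + v : ℝ) : ℂ) * Complex.I)‖ ≤ b n) ∧
          ∑' n, b n ≤ K * ((∫ t, ‖f t‖) + ∫ t, ‖iteratedDeriv k f t‖) := by
  intro x C D N hP
  -- the partial-sum bound `B` and the displacement factor `M`
  set B : ℝ := C * 2 ^ (2 * N + 2) * ∑' m : ℤ, ((1 + |(m : ℝ)|) ^ 2)⁻¹ with hB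
  set M : ℝ := 2 ^ (N + 2) * (1 + |D|) ^ (N + 2) with hM
  refine ⟨M * B, N + 2, fun f hf => ?_⟩
  set S : ℝ := (∫ t, ‖f t‖) + ∫ t, ‖iteratedDeriv (N + 2) f t‖ with hS
  have hS0 : 0 ≤ S :=
    add_nonneg (integral_nonneg fun _ => norm_nonneg _) (integral_nonneg fun _ => norm_nonneg _)
  have hM0 : 0 ≤ M := by positivity
  have hw0 : ∀ n, 0 ≤ ((1 + |x n|) ^ (N + 2))⁻¹ := fun n => by positivity
  have hsum := stub_domination_sum_le x C N hP
  have hw : Summable (fun n => ((1 + |x n|) ^ (N + 2))⁻¹) := summable_of_sum_le hw0 hsum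
  have hwB : ∑' n, ((1 + |x n|) ^ (N + 2))⁻¹ ≤ B := Real.tsum_le_of_sum_le hw0 hsum
  refine ⟨fun n => S * M * ((1 + |x n|) ^ (N + 2))⁻¹, hw.mul_left (S * M), fun n v hv => ?_, ?_⟩
  · -- the pointwise domination
    refine (stub_domination_decay hf (N + 2) (x n + v)).trans ?_
    have hxn : (0 : ℝ) < 1 + |x n| := by positivity
    have hxv : (0 : ℝ) < 1 + |x n + v| := by positivity
    have hbase : 1 + |x n| ≤ (1 + |x n + v|) * (1 + |D|) := by
      have h1 : |x n| ≤ |x n + v| + |v| := by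
        calc |x n| = |(x n + v) + (-v)| := by congr 1; ring
          _ ≤ |x n + v| + |-v| := abs_add_le _ _
          _ = |x n + v| + |v| := by rw [abs_neg]
      have h2 : |v| ≤ |D| := hv.trans (le_abs_self D)
      nlinarith [abs_nonneg (x n + v), abs_nonneg D]
    have hkey : ((1 + |x n + v|) ^ (N + 2))⁻¹ ≤ (1 + |D|) ^ (N + 2) * ((1 + |x n|) ^ (N + 2))⁻¹ := by
      rw [← div_eq_mul_inv, le_div_iff₀ (pow_pos hxn _), inv_mul_le_iff₀ (pow_pos hxv _),
        ← mul_pow]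
      exact pow_le_pow_left₀ hxn.le hbase _
    calc 2 ^ (N + 2) * S * ((1 + |x n + v|) ^ (N + 2))⁻¹
        ≤ 2 ^ (N + 2) * S * ((1 + |D|) ^ (N + 2) * ((1 + |x n|) ^ (N + 2))⁻¹) := by gcongr
      _ = S * M * ((1 + |x n|) ^ (N + 2))⁻¹ := by rw [hM]; ring
  · -- the bound on the sum
    rw [tsum_mul_left]
    calc S * M * ∑' n, ((1 + |x n|) ^ (N + 2))⁻¹ ≤ S * M * B := by gcongr
      _ = M * B * S := by ring

end Summit.RiemannHypothesis.RiemannHypothesis.Theorems.SpectralTraceWindowTraceArch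

end
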